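import Summits.ValiantsHypothesis.ValiantsHypothesis.Theorems.BinomialElusivePeelingLemmaPlusMinus
import Summits.ValiantsHypothesis.ValiantsHypothesis.Theorems.BinomialElusivePeelingLemmaGadgetBlockBranch

/-!
# The block theta gadget, VII: the two sides of a gadget-restricted relation, `S⁺` and `S⁻` (§3g (E0))

Helper for the crux stmt-ValiantsHypothesis-7391 (negative lane; `Cruxes/PeelingLemma/DETERMINISTIC-ALLX.md`
§3g/§3h (E0), (E0′)).  Edge `t < L` of arm `j` (joining the positions `2q+t`, `2q+t+1`) carries the
coefficients `u j t` and `v j t`; with `W j t := win (birth3 j) q (2q+t)` the `ψ`-side of the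
relation restricted to the gadget is `S¹ = Σ_j Σ_t (u j t · W j t + v j t · W j (t+1))` and the
`ψ'`-side, read on the identified alphabet, is `S² = Σ_j Σ_t (v j t · W j t + u j t · W j (t+1))`.
This file proves the two working formulas of §3g: `S¹ + S² = Σ_j Σ_t (u+v) j t · ([birth3 j (2q+t+1) = ·]
+ [birth3 j t = ·])` (`sides_add_eq`, the input of `plus_apply_*`) and the per-arm Abel form of
`S¹ - S²` (`arm_sides_sub_eq`: vertex charges `d j t - d j (t-1)`, `d = u - v`, plus the two boundary
terms at `b` and at the top).  No Theses import.
-/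

namespace Summit.ValiantsHypothesis.ValiantsHypothesis.Theorems.PeelingLemmaGadget

-- summit = sub-problem name (single-conjunct summit, D-0017 layout), so the namespace repeats it
set_option linter.dupNamespace false

open scoped BigOperators
open Finset
open Summit.ValiantsHypothesis.ValiantsHypothesis.Theorems.PeelingLemmaWindow

variable {q R no : ℕ}

/-- **(E0) `S¹ + S²` is local.**  Summing the two sides edge by edge gives the pair labels weighted by
`a = u + v`: the letter born at the upper end `2q+t+1` and the letter dying on the edge (born at `t`). -/
theorem sides_add_eq (u v : Fin 5 → ℕ → ℤ) (L : ℕ) (ν : GLetter q no) :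
    (∑ j, ∑ t ∈ Finset.range L,
        (u j t * win (birth3 q R no j) q ((2 * q + t : ℕ) : ℤ) ν +
          v j t * win (birth3 q R no j) q ((2 * q + t + 1 : ℕ) : ℤ) ν)) +
      ∑ j, ∑ t ∈ Finset.range L,
        (v j t * win (birth3 q R no j) q ((2 * q + t : ℕ) : ℤ) ν +
          u j t * win (birth3 q R no j) q ((2 * q + t + 1 : ℕ) : ℤ) ν) =
      ∑ j, ∑ t ∈ Finset.range L, (u j t + v j t) *
        ((if birth3 q R no j ((2 * q + t + 1 : ℕ) : ℤ) = ν then 1 else 0) +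
          (if birth3 q R no j (t : ℤ) = ν then 1 else 0)) := by
  rw [← Finset.sum_add_distrib]
  refine Finset.sum_congr rfl fun j _ => ?_
  rw [← Finset.sum_add_distrib]
  refine Finset.sum_congr rfl fun t _ => ?_
  have h := win_add_win_succ (birth3 q R no j) q ((2 * q + t : ℕ) : ℤ) ν
  have e2 : ((2 * q + t : ℕ) : ℤ) + 1 = ((2 * q + t + 1 : ℕ) : ℤ) := by push_cast; ring
  have e3 : ((2 * q + t : ℕ) : ℤ) - 2 * (q : ℤ) = (t : ℤ) := by push_cast; ring
  rw [e2, e3] at h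
  -- `h : W t + W (t+1) = [born] + [dies]`
  calc u j t * win (birth3 q R no j) q ((2 * q + t : ℕ) : ℤ) ν +
          v j t * win (birth3 q R no j) q ((2 * q + t + 1 : ℕ) : ℤ) ν +
        (v j t * win (birth3 q R no j) q ((2 * q + t : ℕ) : ℤ) ν +
          u j t * win (birth3 q R no j) q ((2 * q + t + 1 : ℕ) : ℤ) ν)
      = (u j t + v j t) * (win (birth3 q R no j) q ((2 * q + t : ℕ) : ℤ) ν +
          win (birth3 q R no j) q ((2 * q + t + 1 : ℕ) : ℤ) ν) := by ring
    _ = _ := by rw [h]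

/-- **(E0′) `S¹ - S²` along one arm, Abel-summed.**  With `d = u - v`:
`Σ_{t<L} (u W t + v W (t+1)) - Σ_{t<L} (v W t + u W (t+1)) = Σ_{t<L} (d t - d (t-1)) W t - d (L-1) W L`
(`d (-1) := 0`; the `t = 0` term is the charge `d 0` at `b`, the last term the charge at the top). -/
theorem arm_sides_sub_eq (f : ℤ → GLetter q no) (u v : ℕ → ℤ) (L : ℕ) (ν : GLetter q no) :
    (∑ t ∈ Finset.range L, (u t * win f q ((2 * q + t : ℕ) : ℤ) ν + v t * win f q ((2 * q + t + 1 : ℕ) : ℤ) ν)) -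
        ∑ t ∈ Finset.range L, (v t * win f q ((2 * q + t : ℕ) : ℤ) ν + u t * win f q ((2 * q + t + 1 : ℕ) : ℤ) ν) =
      (∑ t ∈ Finset.range L,
          ((u t - v t) - (if t = 0 then 0 else (u (t - 1) - v (t - 1)))) * win f q ((2 * q + t : ℕ) : ℤ) ν) -
        (if L = 0 then 0 else (u (L - 1) - v (L - 1)) * win f q ((2 * q + L : ℕ) : ℤ) ν) := by
  -- edgewise difference
  have h1 : (∑ t ∈ Finset.range L,
        (u t * win f q ((2 * q + t : ℕ) : ℤ) ν + v t * win f q ((2 * q + t + 1 : ℕ) : ℤ) ν)) -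
        ∑ t ∈ Finset.range L,
          (v t * win f q ((2 * q + t : ℕ) : ℤ) ν + u t * win f q ((2 * q + t + 1 : ℕ) : ℤ) ν) =
      ∑ t ∈ Finset.range L, (u t - v t) *
        (win f q ((2 * q + t : ℕ) : ℤ) ν - win f q ((2 * q + t + 1 : ℕ) : ℤ) ν) := by
    rw [← Finset.sum_sub_distrib]
    refine Finset.sum_congr rfl fun t _ => ?_
    ring
  rw [h1]
  -- Abel summation with `W p := win f q p ν`, `d' p := u (p - 2q).toNat - v (p - 2q).toNat`, `a := 2q`
  have h2 := sum_mul_sub_succ_eq (fun p => win f q p ν)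
    (fun p => u (p - 2 * q).toNat - v (p - 2 * q).toNat) (2 * q) L
  have key : ∀ i : ℕ, ((2 * (q : ℤ) + (i : ℤ)) - 2 * q).toNat = i := fun i => by
    rw [add_sub_cancel_left]; exact Int.toNat_natCast i
  simp only [key] at h2
  have e2 : ∀ i : ℕ, (2 * (q : ℤ) + (i : ℤ) + 1) = ((2 * q + i + 1 : ℕ) : ℤ) := fun i => by
    push_cast; ring
  have e1 : ∀ i : ℕ, (2 * (q : ℤ) + (i : ℤ)) = ((2 * q + i : ℕ) : ℤ) := fun i => by push_cast; ring
  simp only [e2] at h2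
  simp only [e1] at h2
  rw [h2]
  congr 1
  · refine Finset.sum_congr rfl fun t ht => ?_
    congr 1
    by_cases h0 : t = 0
    · rw [if_pos h0, if_pos h0]
    · rw [if_neg h0, if_neg h0]
      have : (((2 * q + t : ℕ) : ℤ) - 1 - 2 * q).toNat = t - 1 := by
        have ht1 : 1 ≤ t := Nat.one_le_iff_ne_zero.mpr h0
        rw [show ((2 * q + t : ℕ) : ℤ) - 1 - 2 * q = ((t - 1 : ℕ) : ℤ) by push_cast [Nat.cast_sub ht1]; ring]
        exact Int.toNat_natCast _
      rw [this]
  · by_cases hL : L = 0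
    · rw [if_pos hL, if_pos hL]
    · rw [if_neg hL, if_neg hL]
      have hL1 : 1 ≤ L := Nat.one_le_iff_ne_zero.mpr hL
      have : (((2 * q + L : ℕ) : ℤ) - 1 - 2 * q).toNat = L - 1 := by
        rw [show ((2 * q + L : ℕ) : ℤ) - 1 - 2 * q = ((L - 1 : ℕ) : ℤ) by push_cast [Nat.cast_sub hL1]; ring]
        exact Int.toNat_natCast _
      rw [this]

end Summit.ValiantsHypothesis.ValiantsHypothesis.Theorems.PeelingLemmaGadget
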